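import Summits.QuantumFields.YangMills.Theorems.BalabanUVNodesPortU8WindowDomains

/-!
# PORT PT-B (U8), g3 file 8 — THE WINDOW PROBLEM UNDER THE CENTRED LIFT: exterior–exterior bonds, coarse bonds touching the window, the constraints `Q`, the gauge kernel `N(Q′)`,
# and the two pairings `⟨Δn, ∂*A⟩`, `⟨∂A, ∂v⟩` are carried from `T_K` to `T_{K+1}` along `liftSiteCtr ∕ liftBondCtr` (push-forward by zero ∕ pull-back) under `NoWrapAt` —
# fifth part of the (R4ᴰ-Loc) TRANSPORT lemma (the `IsCritical` transport itself is file 9)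

Cell `ym-nodeO-ideate` ∕ `ym-balaban-port`, porter `ymgap-nodeO-port-PTB-1` (gen 3), item **stmt-QuantumFields-27931** `BalabanUVNodes.PortPieceLocalityU8`
(text ⁷⁗ «v10-Loc» `d796c7a1386a82f1`).  `--supports stmt-QuantumFields-27931` (helper).  [B6] = [Balaban1984PropagatorsII], [B5] = [Balaban1984PropagatorsI], [I] = [Balaban1987RG1].

WHAT THIS FILE PROVES (theorems only; no `def ∕ instance ∕ notation ∕ sorry`; standard axioms), `W = recordWindow F k K R z₀`, `W′ = recordWindow F k (K+1) R z₀`, `NoWrapAt F k K R z₀`: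
* §1 `extExt_liftBondCtr ∕ extExt_of_liftBondCtr` (a fine bond is exterior–exterior iff its lift is), `touch_liftBondCtr`, `exists_coarse_lift_of_touch` (the coarse bonds touching `W′` are exactly
  the lifts of those touching `W`, and both ends of such a bond lie in the cube of radius `R + 1`);
* §2 `bondAvgIter_extend_liftBondCtr` ∕ `bondAvgIter_comp_liftBondCtr` (`Q_{k+1}` of the push-forward ∕ pull-back on the touching bonds);
* §3 `comp_lift_mem_ker_QpE` ∕ `extend_mem_ker_QpE` (`N(Q′)` is carried both ways);
* §4 ★ `sum_laplace_mul_diverg_lift` (`Σ′ (Δn′)(∂*A′) = Σ (Δ(n′∘lift))(∂*(A′∘lift))` for `n′` vanishing off the window region), ★ `sum_curl_mul_curl_lift`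
  (`Σ′ (∂A′)(∂v′) = Σ (∂(A′∘lift))(∂(v′∘lift))` for `A′` vanishing on the exterior–exterior bonds).
HONEST FRAMING.  Bookkeeping; nothing of Bałaban asserted∕ported∕discharged; 27931 OPEN · SIGNED v10-Loc · close HOLD (№495); K0⁷ OPEN; NODE O 0∕1; COUNT 8∕28 · K 1∕4 UNMOVED;
finite `𝕋⁴_{L^K}` at fixed ε — NOT continuum ∕ OS ∕ Clay; **the Yang–Mills mass gap (Clay) is NOT proved by any of this.**
-/

noncomputable section

open scoped BigOperators

namespace Summit.QuantumFields.YangMills.Theorems.PortU8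

open Literature.MathematicalPhysics.QuantumFieldTheory.Balaban1983to89
open Literature.MathematicalPhysics.QuantumFieldTheory.Balaban1983to89.Node00
open Literature.MathematicalPhysics.QuantumFieldTheory.Balaban1983to89.T4Continuum (T4Family)
open Literature.MathematicalPhysics.QuantumFieldTheory.Balaban1983to89.B5Eq118OneStroke (iterBlockOf iterBlock)
open Literature.MathematicalPhysics.QuantumFieldTheory.Balaban1983to89.LatticeFieldCalculus
open Literature.MathematicalPhysics.QuantumFieldTheory.Balaban1983to89.B6SectAOperatorsV1 (QE QpE)
open Literature.MathematicalPhysics.QuantumFieldTheory.BalabanImbrieJaffe1984to88.BIJ85AxialPropagator411 (BondSpace PlaqSpace)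
open Summit.QuantumFields.YangMills.Theorems.K0RecordFormatNames

variable (F : T4Family) {k K R : ℕ} {z₀ : Fin 4 → ℤ}

/-! ## §1  Exterior–exterior fine bonds and window-touching coarse bonds under the lift -/

/-- `12 ≤ L^{k+1}` (the record has `L > 11`): every fine margin used below (`≤ 3` steps) is less than a block. [cite: Balaban1987RG1, (0.1) p.251 (bookkeeping)] -/
theorem twelve_le_L_pow (k : ℕ) : (12 : ℤ) ≤ (F.L : ℤ) ^ (k + 1) := by
  have h11 : 11 < F.L := F.hL11
  have hL : (12 : ℤ) ≤ F.L := by exact_mod_cast h11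
  calc (12 : ℤ) ≤ F.L := hL
    _ = (F.L : ℤ) ^ 1 := (pow_one _).symm
    _ ≤ (F.L : ℤ) ^ (k + 1) := pow_le_pow_right₀ (by linarith) (by omega)

/-- `NoWrapAt` with the evenness of `N_{k+1} = 2L^{m+K−k−1}`: two more blocks of no-reach slack in the weak form, `2(|z₀ i| + R′) ≤ N` for `R′ ≤ R + 2`.
[cite: Balaban1987RG1, (1.21) p.264 (bookkeeping)] -/
theorem NoWrapAt.two_mul_le (h : NoWrapAt F k K R z₀) {R' : ℕ} (hR : R' ≤ R + 2) (i : Fin 4) : 2 * (|z₀ i| + R') ≤ ((F.P K).sitesPerDir (k + 1) : ℤ) := by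
  have := h i
  have hN : ((F.P K).sitesPerDir (k + 1) : ℤ) = 2 * (F.L : ℤ) ^ (F.m + K - (k + 1)) := by
    rw [show (F.P K).sitesPerDir (k + 1) = 2 * F.L ^ (F.m + K - (k + 1)) from rfl]; push_cast; ring
  have hR' : (R' : ℤ) ≤ R + 2 := by exact_mod_cast hR
  rw [hN] at this ⊢; omega

/-- **A fine bond is exterior–exterior iff its centred lift is** (⇒). [cite: Balaban1987RG1, (1.21) p.264 (bookkeeping)] -/
theorem extExt_liftBondCtr (hk : k + 1 ≤ F.m + K) (hnw : NoWrapAt F k K R z₀) {b : PBond (F.P K) 0}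
    (hs : iterBlockOf (k + 1) b.src ∉ recordWindow F k K R z₀) (ht : iterBlockOf (k + 1) b.tgt ∉ recordWindow F k K R z₀) :
    iterBlockOf (k + 1) (liftBondCtr F K 0 b).src ∉ recordWindow F k (K + 1) R z₀ ∧ iterBlockOf (k + 1) (liftBondCtr F K 0 b).tgt ∉ recordWindow F k (K + 1) R z₀ := by
  have h12 := twelve_le_L_pow F k
  refine ⟨fun h => hs ((iterBlockOf_liftSiteCtr_mem_iff F hk hnw b.src).1 h), fun h => ht ?_⟩
  -- `(lift b₋) + e = lift s` for some `s` over the window; then `b₋ = s − e`, `b₊ = s`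
  obtain ⟨s, hsW, hls⟩ := exists_eq_lift_of_iterBlockOf_mem_succ F hk hnw h
  obtain ⟨z, hzs, hz⟩ := exists_inBox_of_iterBlockOf_mem F hk (fun i => NoWrapAt.two_mul_lt F hnw (Nat.le_succ R) i) hsW
  have h1 : liftSiteCtr F K 0 (s.unshift b.dir) = liftSiteCtr F K 0 b.src := by
    rw [← hzs, liftSiteCtr_unshift_of_inBox F hk hnw (j := 0) (by push_cast; omega) hz, ← liftSiteCtr_siteOfInt_of_inBox F hk hnw (j := 0) (by push_cast; omega) hz, hzs, hls]
    exact unshift_shift' F _ _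
  have h2 : s.unshift b.dir = b.src := liftSiteCtr_injective F K 0 (Nat.zero_le _) h1
  have h3 : b.tgt = s := by rw [show b.tgt = b.src.shift b.dir from rfl, ← h2, shift_unshift' F]
  rw [h3]; exact hsW

/-- **A fine bond is exterior–exterior iff its centred lift is** (⇐). [cite: Balaban1987RG1, (1.21) p.264 (bookkeeping)] -/
theorem extExt_of_liftBondCtr (hk : k + 1 ≤ F.m + K) (hnw : NoWrapAt F k K R z₀) {b : PBond (F.P K) 0}
    (hs : iterBlockOf (k + 1) (liftBondCtr F K 0 b).src ∉ recordWindow F k (K + 1) R z₀) (ht : iterBlockOf (k + 1) (liftBondCtr F K 0 b).tgt ∉ recordWindow F k (K + 1) R z₀) :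
    iterBlockOf (k + 1) b.src ∉ recordWindow F k K R z₀ ∧ iterBlockOf (k + 1) b.tgt ∉ recordWindow F k K R z₀ := by
  have h12 := twelve_le_L_pow F k
  refine ⟨fun h => hs ((iterBlockOf_liftSiteCtr_mem_iff F hk hnw b.src).2 h), fun h => ht ?_⟩
  obtain ⟨z, hzs, hz⟩ := exists_inBox_of_iterBlockOf_mem F hk (fun i => NoWrapAt.two_mul_lt F hnw (Nat.le_succ R) i) h
  -- `b₋ = Φ (z − e)`, so `(lift b₋) + e = Φ′ z = lift b₊`
  have hsrc : b.src = siteOfInt F K 0 (z - Pi.single (Fin.cast (F.P_d K) b.dir) 1) := eq_siteOfInt_sub_of_shift_eq F (by rw [hzs]; rfl)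
  have h1 : (liftBondCtr F K 0 b).tgt = liftSiteCtr F K 0 b.tgt := by
    show (liftSiteCtr F K 0 b.src).shift b.dir = liftSiteCtr F K 0 (b.src.shift b.dir)
    rw [hsrc, liftSiteCtr_shift_of_inBox F hk hnw (j := 1) (by push_cast; omega) (inBox_sub_single F _ hz),
      liftSiteCtr_siteOfInt_of_inBox F hk hnw (j := 1) (by push_cast; omega) (inBox_sub_single F _ hz)]
  rw [h1, iterBlockOf_liftSiteCtr_mem_iff F hk hnw]
  exact h

/-- **Integer coordinates of a coarse bond touching the window**: `c₋ = Φ a`, `c₊ = Φ (a + e_{dir})` with both labels within `R + 1` of `z₀`. [cite: Balaban1987RG1, (1.21) p.264 (bookkeeping)] -/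
theorem exists_coords_of_touch (hnw : NoWrapAt F k K R z₀) {c : PBond (F.P K) (k + 1)}
    (hc : c.src ∈ recordWindow F k K R z₀ ∨ c.tgt ∈ recordWindow F k K R z₀) :
    ∃ a : Fin 4 → ℤ, siteOfInt F K (k + 1) a = c.src ∧ (∀ i, |a i - z₀ i| ≤ R + 1) ∧ ∀ i, |(a + Pi.single (Fin.cast (F.P_d K) c.dir) (1 : ℤ) : Fin 4 → ℤ) i - z₀ i| ≤ R + 1 := by
  have hcR : ∀ i, 2 * (|z₀ i| + R) < ((F.P K).sitesPerDir (k + 1) : ℤ) := fun i => NoWrapAt.two_mul_lt F hnw (Nat.le_succ R) i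
  have hδ : ∀ i, |(Pi.single (Fin.cast (F.P_d K) c.dir) (1 : ℤ) : Fin 4 → ℤ) i| ≤ 1 := fun i => by
    by_cases h : i = Fin.cast (F.P_d K) c.dir
    · subst h; simp
    · rw [Pi.single_eq_of_ne h]; simp
  rcases hc with h | h
  · set a : Fin 4 → ℤ := fun i => ((c.src (Fin.cast (F.P_d K).symm i)).valMinAbs : ℤ)
    have hay : siteOfInt F K (k + 1) a = c.src := siteOfInt_valMinAbs F K (k + 1) c.src
    rw [← hay, mem_recordWindow_siteOfInt_iff F k K R z₀ a hcR fun i => two_mul_abs_valMinAbs_le F K (k + 1) c.src _] at h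
    refine ⟨a, hay, fun i => (h i).trans (by linarith), fun i => ?_⟩
    rw [Pi.add_apply]
    calc |a i + (Pi.single (Fin.cast (F.P_d K) c.dir) (1 : ℤ) : Fin 4 → ℤ) i - z₀ i| = |(a i - z₀ i) + (Pi.single (Fin.cast (F.P_d K) c.dir) (1 : ℤ) : Fin 4 → ℤ) i| := by ring_nf
      _ ≤ |a i - z₀ i| + |(Pi.single (Fin.cast (F.P_d K) c.dir) (1 : ℤ) : Fin 4 → ℤ) i| := abs_add_le _ _
      _ ≤ R + 1 := by linarith [h i, hδ i]
  · set t : Fin 4 → ℤ := fun i => ((c.tgt (Fin.cast (F.P_d K).symm i)).valMinAbs : ℤ)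
    have hty : siteOfInt F K (k + 1) t = c.tgt := siteOfInt_valMinAbs F K (k + 1) c.tgt
    rw [← hty, mem_recordWindow_siteOfInt_iff F k K R z₀ t hcR fun i => two_mul_abs_valMinAbs_le F K (k + 1) c.tgt _] at h
    refine ⟨t - Pi.single (Fin.cast (F.P_d K) c.dir) 1, ?_, fun i => ?_, fun i => ?_⟩
    · rw [siteOfInt_sub_single, hty]; exact unshift_shift' F _ _
    · rw [Pi.sub_apply]
      calc |t i - (Pi.single (Fin.cast (F.P_d K) c.dir) (1 : ℤ) : Fin 4 → ℤ) i - z₀ i| = |(t i - z₀ i) - (Pi.single (Fin.cast (F.P_d K) c.dir) (1 : ℤ) : Fin 4 → ℤ) i| := by ring_nf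
        _ ≤ |t i - z₀ i| + |(Pi.single (Fin.cast (F.P_d K) c.dir) (1 : ℤ) : Fin 4 → ℤ) i| := abs_sub _ _
        _ ≤ R + 1 := by linarith [h i, hδ i]
    · rw [sub_add_cancel]; exact (h i).trans (by linarith)

/-- ★ **A coarse bond touching the window has both ends in the cube of radius `R + 1`, its lift has the lifted ends, and its lift touches the lifted window.**
[cite: Balaban1987RG1, (1.21) p.264 (bookkeeping)] -/
theorem touch_liftBondCtr (hk : k + 1 ≤ F.m + K) (hnw : NoWrapAt F k K R z₀) {c : PBond (F.P K) (k + 1)}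
    (hc : c.src ∈ recordWindow F k K R z₀ ∨ c.tgt ∈ recordWindow F k K R z₀) :
    ((liftBondCtr F K (k + 1) c).src ∈ recordWindow F k (K + 1) R z₀ ∨ (liftBondCtr F K (k + 1) c).tgt ∈ recordWindow F k (K + 1) R z₀) ∧
      c.src ∈ recordWindow F k K (R + 1) z₀ ∧ c.tgt ∈ recordWindow F k K (R + 1) z₀ ∧ (liftBondCtr F K (k + 1) c).tgt = liftSiteCtr F K (k + 1) c.tgt := by
  have hcR : ∀ i, 2 * (|z₀ i| + R) < ((F.P K).sitesPerDir (k + 1) : ℤ) := fun i => NoWrapAt.two_mul_lt F hnw (Nat.le_succ R) i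
  have hcR1 : ∀ i, 2 * (|z₀ i| + (R + 1 : ℕ)) < ((F.P K).sitesPerDir (k + 1) : ℤ) := fun i => NoWrapAt.two_mul_lt F hnw le_rfl i
  obtain ⟨a, hay, ha1, ha2⟩ := exists_coords_of_touch F hnw hc
  have htgt_eq : c.tgt = siteOfInt F K (k + 1) (a + Pi.single (Fin.cast (F.P_d K) c.dir) 1) := by rw [siteOfInt_add_single, hay]; rfl
  have hac : ∀ i, 2 * |a i| < ((F.P K).sitesPerDir (k + 1) : ℤ) := fun i => by
    have : |a i| ≤ |z₀ i| + (R + 1 : ℕ) := by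
      calc |a i| = |(a i - z₀ i) + z₀ i| := by ring_nf
        _ ≤ |a i - z₀ i| + |z₀ i| := abs_add_le _ _
        _ ≤ |z₀ i| + (R + 1 : ℕ) := by push_cast; linarith [ha1 i]
    linarith [hcR1 i]
  have hac' : ∀ i, 2 * |(a + Pi.single (Fin.cast (F.P_d K) c.dir) (1 : ℤ) : Fin 4 → ℤ) i| < ((F.P K).sitesPerDir (k + 1) : ℤ) := fun i => by
    have : |(a + Pi.single (Fin.cast (F.P_d K) c.dir) (1 : ℤ) : Fin 4 → ℤ) i| ≤ |z₀ i| + (R + 1 : ℕ) := by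
      calc _ = |((a + Pi.single (Fin.cast (F.P_d K) c.dir) (1 : ℤ) : Fin 4 → ℤ) i - z₀ i) + z₀ i| := by ring_nf
        _ ≤ _ := abs_add_le _ _
        _ ≤ |z₀ i| + (R + 1 : ℕ) := by push_cast; linarith [ha2 i]
    linarith [hcR1 i]
  have hsrc1 : c.src ∈ recordWindow F k K (R + 1) z₀ := by
    rw [← hay, mem_recordWindow_siteOfInt_iff F k K (R + 1) z₀ a hcR1 fun i => (hac i).le]; push_cast; exact ha1
  have htgt1 : c.tgt ∈ recordWindow F k K (R + 1) z₀ := by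
    rw [htgt_eq, mem_recordWindow_siteOfInt_iff F k K (R + 1) z₀ _ hcR1 fun i => (hac' i).le]; push_cast; exact ha2
  have hltgt : (liftBondCtr F K (k + 1) c).tgt = liftSiteCtr F K (k + 1) c.tgt := by
    show (liftSiteCtr F K (k + 1) c.src).shift c.dir = liftSiteCtr F K (k + 1) (c.src.shift c.dir)
    rw [← hay, liftSiteCtr_shift_of F K (k + 1) a c.dir (fun i => mem_Ioc_of_two_mul_abs_lt (hac i)) (fun i => mem_Ioc_of_two_mul_abs_lt (hac' i))]
  refine ⟨?_, hsrc1, htgt1, hltgt⟩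
  rcases hc with h | h
  · left; rw [show (liftBondCtr F K (k + 1) c).src = liftSiteCtr F K (k + 1) c.src from rfl, liftSiteCtr_mem_recordWindow_iff F k K R hk z₀ hcR]; exact h
  · right; rw [hltgt, liftSiteCtr_mem_recordWindow_iff F k K R hk z₀ hcR]; exact h

/-- ★ **The coarse bonds touching the lifted window are exactly the lifts of those touching the window.** [cite: Balaban1987RG1, (1.21) p.264 (bookkeeping)] -/
theorem exists_coarse_lift_of_touch (hk : k + 1 ≤ F.m + K) (hnw : NoWrapAt F k K R z₀) {c' : PBond (F.P (K + 1)) (k + 1)}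
    (hc' : c'.src ∈ recordWindow F k (K + 1) R z₀ ∨ c'.tgt ∈ recordWindow F k (K + 1) R z₀) :
    ∃ c : PBond (F.P K) (k + 1), (c.src ∈ recordWindow F k K R z₀ ∨ c.tgt ∈ recordWindow F k K R z₀) ∧ liftBondCtr F K (k + 1) c = c' := by
  have hcR : ∀ i, 2 * (|z₀ i| + R) < ((F.P K).sitesPerDir (k + 1) : ℤ) := fun i => NoWrapAt.two_mul_lt F hnw (Nat.le_succ R) i
  have hcR1 : ∀ i, 2 * (|z₀ i| + (R + 1 : ℕ)) < ((F.P K).sitesPerDir (k + 1) : ℤ) := fun i => NoWrapAt.two_mul_lt F hnw le_rfl i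
  -- integer coordinates in the BIG volume (same window, same box)
  obtain ⟨a, hay, ha1, ha2⟩ := exists_coords_of_touch F (K := K + 1) (NoWrapAt.succ_vol F hnw hk) hc'
  have hcast : (Fin.cast (F.P_d (K + 1)) c'.dir : Fin 4) = Fin.cast (F.P_d K) c'.dir := Fin.ext rfl
  rw [hcast] at ha2
  have hac : ∀ i, 2 * |a i| < ((F.P K).sitesPerDir (k + 1) : ℤ) := fun i => by
    have : |a i| ≤ |z₀ i| + (R + 1 : ℕ) := by
      calc |a i| = |(a i - z₀ i) + z₀ i| := by ring_nf
        _ ≤ |a i - z₀ i| + |z₀ i| := abs_add_le _ _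
        _ ≤ |z₀ i| + (R + 1 : ℕ) := by push_cast; linarith [ha1 i]
    linarith [hcR1 i]
  refine ⟨⟨siteOfInt F K (k + 1) a, c'.dir⟩, ?_, ?_⟩
  · have hle : ((F.P K).sitesPerDir (k + 1) : ℤ) ≤ (F.P (K + 1)).sitesPerDir (k + 1) := by exact_mod_cast sitesPerDir_le_succ_vol F K (k + 1) hk
    rcases hc' with h | h
    · left
      rw [← hay, mem_recordWindow_siteOfInt_iff F k (K + 1) R z₀ a (fun i => lt_of_lt_of_le (hcR i) hle) fun i => (hac i).le.trans hle] at h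
      rw [mem_recordWindow_siteOfInt_iff F k K R z₀ a hcR fun i => (hac i).le]; exact h
    · right
      have hac' : ∀ i, 2 * |(a + Pi.single (Fin.cast (F.P_d K) c'.dir) (1 : ℤ) : Fin 4 → ℤ) i| < ((F.P K).sitesPerDir (k + 1) : ℤ) := fun i => by
        have : |(a + Pi.single (Fin.cast (F.P_d K) c'.dir) (1 : ℤ) : Fin 4 → ℤ) i| ≤ |z₀ i| + (R + 1 : ℕ) := by
          calc _ = |((a + Pi.single (Fin.cast (F.P_d K) c'.dir) (1 : ℤ) : Fin 4 → ℤ) i - z₀ i) + z₀ i| := by ring_nf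
            _ ≤ _ := abs_add_le _ _
            _ ≤ |z₀ i| + (R + 1 : ℕ) := by push_cast; linarith [ha2 i]
        linarith [hcR1 i]
      have htgt' : c'.tgt = siteOfInt F (K + 1) (k + 1) (a + Pi.single (Fin.cast (F.P_d K) c'.dir) 1) := by
        rw [show c'.tgt = c'.src.shift c'.dir from rfl, ← hay, ← siteOfInt_add_single]; rfl
      rw [htgt', mem_recordWindow_siteOfInt_iff F k (K + 1) R z₀ _ (fun i => lt_of_lt_of_le (hcR i) hle) fun i => (hac' i).le.trans hle] at h
      rw [show (⟨siteOfInt F K (k + 1) a, c'.dir⟩ : PBond (F.P K) (k + 1)).tgt = (siteOfInt F K (k + 1) a).shift c'.dir from rfl, ← siteOfInt_add_single,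
        mem_recordWindow_siteOfInt_iff F k K R z₀ _ hcR fun i => (hac' i).le]
      exact h
  · show (⟨liftSiteCtr F K (k + 1) (siteOfInt F K (k + 1) a), c'.dir⟩ : PBond (F.P (K + 1)) (k + 1)) = c'
    rw [liftSiteCtr_siteOfInt F K (k + 1) a fun i => mem_Ioc_of_two_mul_abs_lt (hac i), hay]

/-! ## §2  `Q_{k+1}` of the push-forward ∕ pull-back on the window-touching coarse bonds -/

/-- ★ **`(Q_{k+1} (push-forward g))(lift c) = (Q_{k+1} g)(c)`** for a coarse bond `c` touching the window. [cite: Balaban1984PropagatorsI, (1.18) p.20; Balaban1987RG1, (1.21) p.264] -/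
theorem bondAvgIter_extend_liftBondCtr (hk : k + 1 ≤ F.m + K) (hnw : NoWrapAt F k K R z₀) {c : PBond (F.P K) (k + 1)}
    (hc : c.src ∈ recordWindow F k K R z₀ ∨ c.tgt ∈ recordWindow F k K R z₀) (g : PBond (F.P K) 0 → ℝ) :
    bondAvgIter (k + 1) (Function.extend (liftBondCtr F K 0) g 0) (liftBondCtr F K (k + 1) c) = bondAvgIter (k + 1) g c := by
  obtain ⟨-, hs1, ht1, -⟩ := touch_liftBondCtr F hk hnw hc
  have hcR2 : ∀ i, 2 * (|z₀ i| + (R + 1 : ℕ) + 1) ≤ ((F.P K).sitesPerDir (k + 1) : ℤ) := fun i => by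
    have := NoWrapAt.two_mul_le F hnw (le_refl (R + 2)) i; push_cast at this ⊢; linarith
  rw [bondAvgIter_liftBondCtr F hk hcR2 hs1 ht1]
  congr 1
  funext b
  exact extend_liftBondCtr_apply F K g b

/-- ★ **`(Q_{k+1} (v′ ∘ lift))(c) = (Q_{k+1} v′)(lift c)`** for a coarse bond `c` touching the window. [cite: Balaban1984PropagatorsI, (1.18) p.20; Balaban1987RG1, (1.21) p.264] -/
theorem bondAvgIter_comp_liftBondCtr (hk : k + 1 ≤ F.m + K) (hnw : NoWrapAt F k K R z₀) {c : PBond (F.P K) (k + 1)}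
    (hc : c.src ∈ recordWindow F k K R z₀ ∨ c.tgt ∈ recordWindow F k K R z₀) (v' : PBond (F.P (K + 1)) 0 → ℝ) :
    bondAvgIter (k + 1) (fun b => v' (liftBondCtr F K 0 b)) c = bondAvgIter (k + 1) v' (liftBondCtr F K (k + 1) c) := by
  obtain ⟨-, hs1, ht1, -⟩ := touch_liftBondCtr F hk hnw hc
  have hcR2 : ∀ i, 2 * (|z₀ i| + (R + 1 : ℕ) + 1) ≤ ((F.P K).sitesPerDir (k + 1) : ℤ) := fun i => by
    have := NoWrapAt.two_mul_le F hnw (le_refl (R + 2)) i; push_cast at this ⊢; linarith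
  rw [bondAvgIter_liftBondCtr F hk hcR2 hs1 ht1]

/-! ## §3  `N(Q′)` under the lift -/

/-- ★ **Pull-back: `n′ ∈ N(Q′)` on `T_{K+1}` gives `n′ ∘ lift ∈ N(Q′)` on `T_K`.** [cite: Balaban1984PropagatorsII, (2.7) p.224, (2.10) p.225] -/
theorem comp_lift_mem_ker_QpE (hk : k + 1 ≤ F.m + K) (hnw : NoWrapAt F k K R z₀) (hkK : k + 1 ≤ (F.P K).m + (F.P K).K) (hkK' : k + 1 ≤ (F.P (K + 1)).m + (F.P (K + 1)).K)
    {n' : B6SectAOperatorsV1.ScalarSpace (F.P (K + 1))} (hn' : n' ∈ LinearMap.ker (QpE (windowDomains F k (K + 1) hkK' (recordWindow F k (K + 1) R z₀)))) :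
    (WithLp.toLp 2 fun s => n' (liftSiteCtr F K 0 s) : B6SectAOperatorsV1.ScalarSpace (F.P K)) ∈ LinearMap.ker (QpE (windowDomains F k K hkK (recordWindow F k K R z₀))) := by
  rw [mem_ker_QpE_windowDomains_iff] at hn' ⊢
  obtain ⟨h0, htop⟩ := hn'
  have hcR : ∀ i, 2 * (|z₀ i| + R) < ((F.P K).sitesPerDir (k + 1) : ℤ) := fun i => NoWrapAt.two_mul_lt F hnw (Nat.le_succ R) i
  have hcR1 : ∀ i, 2 * (|z₀ i| + R + 1) ≤ ((F.P K).sitesPerDir (k + 1) : ℤ) := fun i => by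
    have := NoWrapAt.two_mul_le F hnw (Nat.le_succ (R + 1)) i; push_cast at this; linarith
  refine ⟨fun x hx => ?_, fun y hy => ?_⟩
  · exact h0 _ fun h => hx ((iterBlockOf_liftSiteCtr_mem_iff F hk hnw x).1 h)
  · have := htop (liftSiteCtr F K (k + 1) y) ((liftSiteCtr_mem_recordWindow_iff F k K R hk z₀ hcR y).2 hy)
    rw [siteAvgIter_liftSiteCtr F hk hcR1 hy] at this
    exact this

/-- ★ **Push-forward: `n ∈ N(Q′)` on `T_K` gives `extend lift n 0 ∈ N(Q′)` on `T_{K+1}`.** [cite: Balaban1984PropagatorsII, (2.7) p.224, (2.10) p.225] -/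
theorem extend_mem_ker_QpE (hk : k + 1 ≤ F.m + K) (hnw : NoWrapAt F k K R z₀) (hkK : k + 1 ≤ (F.P K).m + (F.P K).K) (hkK' : k + 1 ≤ (F.P (K + 1)).m + (F.P (K + 1)).K)
    {n : B6SectAOperatorsV1.ScalarSpace (F.P K)} (hn : n ∈ LinearMap.ker (QpE (windowDomains F k K hkK (recordWindow F k K R z₀)))) :
    (WithLp.toLp 2 (Function.extend (liftSiteCtr F K 0) (WithLp.ofLp n) 0) : B6SectAOperatorsV1.ScalarSpace (F.P (K + 1))) ∈
      LinearMap.ker (QpE (windowDomains F k (K + 1) hkK' (recordWindow F k (K + 1) R z₀))) := by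
  rw [mem_ker_QpE_windowDomains_iff] at hn ⊢
  obtain ⟨h0, htop⟩ := hn
  have hcR : ∀ i, 2 * (|z₀ i| + R) < ((F.P K).sitesPerDir (k + 1) : ℤ) := fun i => NoWrapAt.two_mul_lt F hnw (Nat.le_succ R) i
  have hcR1 : ∀ i, 2 * (|z₀ i| + R + 1) ≤ ((F.P K).sitesPerDir (k + 1) : ℤ) := fun i => by
    have := NoWrapAt.two_mul_le F hnw (Nat.le_succ (R + 1)) i; push_cast at this; linarith
  refine ⟨fun x' hx' => ?_, fun y' hy' => ?_⟩
  · show Function.extend (liftSiteCtr F K 0) (WithLp.ofLp n) 0 x' = 0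
    by_cases hr : x' ∈ Set.range (liftSiteCtr F K 0)
    · obtain ⟨x, rfl⟩ := hr
      rw [extend_liftSiteCtr_apply]
      exact h0 x fun h => hx' ((iterBlockOf_liftSiteCtr_mem_iff F hk hnw x).2 h)
    · exact extend_liftSiteCtr_of_not_mem_range F K _ hr
  · obtain ⟨y, hy, rfl⟩ := exists_lift_of_mem_recordWindow_succ F k K R hk z₀ hcR hy'
    show siteAvgIter (k + 1) (Function.extend (liftSiteCtr F K 0) (WithLp.ofLp n) 0) (liftSiteCtr F K (k + 1) y) = 0
    rw [siteAvgIter_liftSiteCtr F hk hcR1 hy]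
    have : (fun s => Function.extend (liftSiteCtr F K 0) (WithLp.ofLp n) 0 (liftSiteCtr F K 0 s)) = WithLp.ofLp n := funext fun s => extend_liftSiteCtr_apply F K _ s
    rw [this]
    exact htop y hy

/-! ## §4  The two pairings under the lift -/

/-- ★★ **`Σ′ (Δn′)(∂*A′) = Σ (Δ(n′ ∘ lift))(∂*(A′ ∘ lift))`** for a function `n′` vanishing off the lifted window region and ANY fine bond field `A′` of `T_{K+1}`.
[cite: Balaban1984PropagatorsII, (2.9) p.224, (2.12) p.225; Balaban1987RG1, (1.21) p.264] -/
theorem sum_laplace_mul_diverg_lift (hk : k + 1 ≤ F.m + K) (hnw : NoWrapAt F k K R z₀) (c : ℝ) {n' : Site (F.P (K + 1)) 0 → ℝ}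
    (hn' : ∀ s', iterBlockOf (k + 1) s' ∉ recordWindow F k (K + 1) R z₀ → n' s' = 0) (A' : PBond (F.P (K + 1)) 0 → ℝ) :
    ∑ s', laplace c n' s' * diverg c A' s' =
      ∑ s, laplace c (fun t => n' (liftSiteCtr F K 0 t)) s * diverg c (fun b => A' (liftBondCtr F K 0 b)) s := by
  classical
  have h12 := twelve_le_L_pow F k
  have hnw' : NoWrapAt F k (K + 1) R z₀ := NoWrapAt.succ_vol F hnw hk
  have hk' : k + 1 ≤ F.m + (K + 1) := by omega
  -- the pulled-back function vanishes off the window region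
  have hn : ∀ s, iterBlockOf (k + 1) s ∉ recordWindow F k K R z₀ → n' (liftSiteCtr F K 0 s) = 0 := fun s hs =>
    hn' _ fun h => hs ((iterBlockOf_liftSiteCtr_mem_iff F hk hnw s).1 h)
  refine sum_eq_sum_of_support_range (liftSiteCtr_injective F K 0 (Nat.zero_le _)) _ _ (fun s' hs' => ?_) (fun s => ?_)
  · -- support: `Δn′(s′) ≠ 0` puts `s′` in `Φ′(Reg_1) = lift (Φ(Reg_1))`
    have hl : laplace c n' s' ≠ 0 := fun h => hs' (by rw [h, zero_mul])
    obtain ⟨z, hzs, hz⟩ := exists_inBox_of_laplace_ne_zero F hk' hnw' c hn' hl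
    exact ⟨siteOfInt F K 0 z, by rw [liftSiteCtr_siteOfInt_of_inBox F hk hnw (j := 1) (by push_cast; omega) hz, hzs]⟩
  · by_cases hreg : ∃ z : Fin 4 → ℤ, siteOfInt F K 0 z = s ∧ ∀ i, (z₀ i - R) * (F.L : ℤ) ^ (k + 1) - (1 : ℕ) ≤ z i ∧ z i ≤ (z₀ i + R + 1) * (F.L : ℤ) ^ (k + 1) - 1 + (1 : ℕ)
    · obtain ⟨z, rfl, hz⟩ := hreg
      have hsh : ∀ μ, liftSiteCtr F K 0 ((siteOfInt F K 0 z).shift μ) = (liftSiteCtr F K 0 (siteOfInt F K 0 z)).shift μ := fun μ => by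
        rw [liftSiteCtr_shift_of_inBox F hk hnw (j := 1) (by push_cast; omega) hz μ, liftSiteCtr_siteOfInt_of_inBox F hk hnw (j := 1) (by push_cast; omega) hz]
      have hush : ∀ μ, liftSiteCtr F K 0 ((siteOfInt F K 0 z).unshift μ) = (liftSiteCtr F K 0 (siteOfInt F K 0 z)).unshift μ := fun μ => by
        rw [liftSiteCtr_unshift_of_inBox F hk hnw (j := 1) (by push_cast; omega) hz μ, liftSiteCtr_siteOfInt_of_inBox F hk hnw (j := 1) (by push_cast; omega) hz]
      rw [laplace_liftSiteCtr F K c n' _ hsh hush, diverg_liftSiteCtr F K c A' _ hush]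
    · -- off `Reg_1` both Laplacians vanish
      have h1 : laplace c (fun t => n' (liftSiteCtr F K 0 t)) s = 0 := by
        by_contra h
        obtain ⟨z, hzs, hz⟩ := exists_inBox_of_laplace_ne_zero F hk hnw c hn h
        exact hreg ⟨z, hzs, hz⟩
      have h2 : laplace c n' (liftSiteCtr F K 0 s) = 0 := by
        by_contra h
        obtain ⟨z, hzs, hz⟩ := exists_inBox_of_laplace_ne_zero F hk' hnw' c hn' h
        rw [← liftSiteCtr_siteOfInt_of_inBox F hk hnw (j := 1) (by push_cast; omega) hz] at hzs
        exact hreg ⟨z, liftSiteCtr_injective F K 0 (Nat.zero_le _) hzs, hz⟩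
      rw [h1, h2, zero_mul, zero_mul]

/-- ★★ **`Σ′ (∂A′)(∂v′) = Σ (∂(A′ ∘ lift))(∂(v′ ∘ lift))`** over plaquettes, for a fine bond field `A′` vanishing on the exterior–exterior bonds of the lifted window and ANY `v′`.
[cite: Balaban1984PropagatorsII, (2.5) p.224, p.228; Balaban1987RG1, (1.21) p.264] -/
theorem sum_curl_mul_curl_lift (hk : k + 1 ≤ F.m + K) (hnw : NoWrapAt F k K R z₀) (c : ℝ) {A' : PBond (F.P (K + 1)) 0 → ℝ}
    (hA' : ∀ b', iterBlockOf (k + 1) b'.src ∉ recordWindow F k (K + 1) R z₀ → iterBlockOf (k + 1) b'.tgt ∉ recordWindow F k (K + 1) R z₀ → A' b' = 0)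
    (v' : PBond (F.P (K + 1)) 0 → ℝ) :
    ∑ p', curl c A' p' * curl c v' p' =
      ∑ p : Plaq (F.P K) 0, curl c (fun b => A' (liftBondCtr F K 0 b)) p * curl c (fun b => v' (liftBondCtr F K 0 b)) p := by
  classical
  have h12 := twelve_le_L_pow F k
  have hnw' : NoWrapAt F k (K + 1) R z₀ := NoWrapAt.succ_vol F hnw hk
  have hk' : k + 1 ≤ F.m + (K + 1) := by omega
  -- the pulled-back field vanishes on the exterior–exterior bonds
  have hA : ∀ b, iterBlockOf (k + 1) b.src ∉ recordWindow F k K R z₀ → iterBlockOf (k + 1) b.tgt ∉ recordWindow F k K R z₀ → A' (liftBondCtr F K 0 b) = 0 :=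
    fun b hs ht => by obtain ⟨hs', ht'⟩ := extExt_liftBondCtr F hk hnw hs ht; exact hA' _ hs' ht'
  -- the plaquette lift and its injectivity
  let lp : Plaq (F.P K) 0 → Plaq (F.P (K + 1)) 0 := fun p => ⟨liftSiteCtr F K 0 p.src, p.μ, p.ν, p.hμν⟩
  have hlp : Function.Injective lp := by
    intro p q h
    have hs : (lp p).src = (lp q).src := congrArg Plaq.src h
    have hμ : (lp p).μ = (lp q).μ := congrArg Plaq.μ h
    have hν : (lp p).ν = (lp q).ν := congrArg Plaq.ν h
    change liftSiteCtr F K 0 p.src = liftSiteCtr F K 0 q.src at hs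
    change p.μ = q.μ at hμ
    change p.ν = q.ν at hν
    cases p; cases q; simp only at hs hμ hν
    subst hμ; subst hν
    simp [liftSiteCtr_injective F K 0 (Nat.zero_le _) hs]
  refine sum_eq_sum_of_support_range hlp _ _ (fun p' hp' => ?_) (fun p => ?_)
  · have hcp : curl c A' p' ≠ 0 := fun h => hp' (by rw [h, zero_mul])
    obtain ⟨z, hzs, hz⟩ := exists_inBox_src_of_curl_ne_zero F hk' hnw' c hA' hcp
    refine ⟨⟨siteOfInt F K 0 z, p'.μ, p'.ν, p'.hμν⟩, ?_⟩
    show (⟨liftSiteCtr F K 0 (siteOfInt F K 0 z), p'.μ, p'.ν, p'.hμν⟩ : Plaq (F.P (K + 1)) 0) = p'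
    rw [liftSiteCtr_siteOfInt_of_inBox F hk hnw (j := 2) (by push_cast; omega) hz, hzs]
  · by_cases hreg : ∃ z : Fin 4 → ℤ, siteOfInt F K 0 z = p.src ∧ ∀ i, (z₀ i - R) * (F.L : ℤ) ^ (k + 1) - (2 : ℕ) ≤ z i ∧ z i ≤ (z₀ i + R + 1) * (F.L : ℤ) ^ (k + 1) - 1 + (2 : ℕ)
    · obtain ⟨z, hzs, hz⟩ := hreg
      have hsh : ∀ μ, liftSiteCtr F K 0 (p.src.shift μ) = (liftSiteCtr F K 0 p.src).shift μ := fun μ => by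
        rw [← hzs, liftSiteCtr_shift_of_inBox F hk hnw (j := 2) (by push_cast; omega) hz μ, liftSiteCtr_siteOfInt_of_inBox F hk hnw (j := 2) (by push_cast; omega) hz]
      show curl c A' ⟨liftSiteCtr F K 0 p.src, p.μ, p.ν, p.hμν⟩ * curl c v' ⟨liftSiteCtr F K 0 p.src, p.μ, p.ν, p.hμν⟩ = _
      rw [curl_liftPlaq F K c A' p (hsh _) (hsh _), curl_liftPlaq F K c v' p (hsh _) (hsh _)]
    · have h1 : curl c (fun b => A' (liftBondCtr F K 0 b)) p = 0 := by
        by_contra h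
        obtain ⟨z, hzs, hz⟩ := exists_inBox_src_of_curl_ne_zero F hk hnw c hA h
        exact hreg ⟨z, hzs, hz⟩
      have h2 : curl c A' (lp p) = 0 := by
        by_contra h
        obtain ⟨z, hzs, hz⟩ := exists_inBox_src_of_curl_ne_zero F hk' hnw' c hA' h
        change siteOfInt F (K + 1) 0 z = liftSiteCtr F K 0 p.src at hzs
        rw [← liftSiteCtr_siteOfInt_of_inBox F hk hnw (j := 2) (by push_cast; omega) hz] at hzs
        exact hreg ⟨z, liftSiteCtr_injective F K 0 (Nat.zero_le _) hzs, hz⟩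
      rw [h1, h2, zero_mul, zero_mul]

end Summit.QuantumFields.YangMills.Theorems.PortU8

end
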